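import Literature.Analysis.FluidPDE.HardSphereCollisionRecord
import Literature.MathematicalPhysics.KineticTheory.HardSphereEuler
import HarnessLib

/-!
# Objects and stub statements of the line `level-census-comparison`
# (crux `EnergyCurrentTails`, stmt-AtomisticToContinuum-9235)

Definitions-only support file (`--supports stmt-AtomisticToContinuum-9235`) of the line lead
(seat c2, `prover-line-stmt-AtomisticToContinuum-9235-c2-0`; skeleton
`Cruxes/EnergyCurrentTails/Lines/level_census_comparison.lean`, planner
`planner-cruxplan-stmt-AtomisticToContinuum-9235-level-census-compari-0`).  It makes the line's
VOCABULARY importable so that each registered stub can land in its own sorry-free Theorems file with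
the registered signature verbatim (`theorem stub_censusLedger : CensusLedger`, …).  §0 is copied
byte-for-byte from the skeleton; §1 names the five stub statements and the two transfer statements
as `Prop`s (the pattern of `…Theorems.InfluenceLocality` objects files).  NOTHING IS ASSERTED here:
the crux decl stays in the route files (`…Theses.WarmColdDichotomy.EnergyCurrentTails`, primary;
`…Theses.OneFlightGossipEngine.EnergyCurrentTails`, byte-identical copy), the composition
`CensusLedger → RateCeiling → MergeCeiling → SplitFloor → GaussianCensusBound → QuarticMomentBound →
crux` stays in the skeleton, and no `Prop` below restates, specialises or strengthens the crux
(`GaussianCensusBound`/`QuarticMomentBound` are the line's TRANSFER statements C⁺ ⟹ C⁺′ ⟹ crux,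
strictly stronger one-time moment/census bounds; the four stub statements are window inequalities
for expected collision counts).

## The objects (§0)

For the flows `Φ : Flow σ N` of the crux frame (`N + 1` spheres of diameter `hsDiameter σ N` on
`𝕋³`) and the local Gibbs law `λ_N = localGibbsLaw σ a₀ u₀ θ₀ N Φ`:
* `levelCensus … s E = E_{λ_N} #{i : E < ‖vᵢ(s)‖²}` (the expected LEVEL CENSUS, `ℝ≥0∞`),
  `shellCensus … s E₁ E₂`, `speedCensus … s Y = E ∑ᵢ 𝟙{Y < ‖vᵢ‖²}‖vᵢ‖`, `kineticEnergy … s`;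
* `eventSum Φ s s' S z` = number of collisions of the orbit of `z` in `(s, s']` whose velocity event
  `((v₁⁻,v₂⁻),(v₁⁺,v₂⁺))` lies in `S` (each physical collision once: guard `fst < snd` on the
  ordered contact pairs of `HardSphereFlow.collisionSum`), `eventCount` its `λ_N`-expectation;
* the accounts of one collision at level `E`: `aboveCount`, `maxPre`, `upEvent`, `downEvent`,
  `shellEvent`, `tailEvent`, `splitEvent`, `mergeEvent`, and the `pairMajorant` of the merge account;
* `clock σ N = σ²(N+1)^{1/3}` (collisions per unit time and unit relative speed).

## The statements (§1)

`CensusLedger` (stub A: crossing ledger + a-priori inputs, no chaos), `RateCeiling` (F1),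
`MergeCeiling` (F2), `SplitFloor` (F3, the hardest), `GaussianCensusBound` (C⁺), `QuarticMomentBound`
(C⁺′ = the hypothesis of the landed Chebyshev docking `…Theorems.LoschmidtTagging.stub_quarticDocking`,
p92098).  Registered stubs of the line (by `ledger workitem stub-add`): `stub_censusLedger : CensusLedger`,
`stub_rateCeiling : RateCeiling`, `stub_mergeCeiling : MergeCeiling`, `stub_splitFloor : SplitFloor`,
`stub_censusClosure : CensusLedger → RateCeiling → MergeCeiling → SplitFloor → GaussianCensusBound`,
the transfer `stub_censusTransfer : GaussianCensusBound → QuarticMomentBound` (proved in the skeleton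
§4; lands in its own file) and the analytic engine `comparison_principle` (§2 below, PROVED: the
registered helper this file lands).

References: Gamba–Panferov–Villani 2009 (comparison principle for upper-Maxwellian bounds, ARMA 194);
Nachtergaele–Yau 2003 §2.3 (cut-off II.1, the target currency); Cercignani–Illner–Pulvirenti 1994 §4
(collision records of the flow).
-/

noncomputable section

open MeasureTheory Set Filter
open scoped ENNReal InnerProductSpace

namespace Summit.AtomisticToContinuum.HydrodynamicLimit.Theorems.EnergyCurrentTailsLevelCensus

open Literature.MathematicalPhysics.KineticTheory Literature.Analysis.FluidPDE

/-! ## §0 Objects: census, shells, velocity-event counts over the collision records -/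

/-- The flows of the crux frame: `N + 1` spheres of diameter `hsDiameter σ N` on `𝕋³`. -/
abbrev Flow (σ : ℝ) (N : ℕ) : Type :=
  HardSphereFlow (Torus.geometry (Fin 3)) (hsDiameter σ N) (N + 1)

/-- A VELOCITY EVENT of one collision: `((v₁⁻, v₂⁻), (v₁⁺, v₂⁺))` (pre- and post-collisional
velocities of the ordered pair; all accounts of the line are Borel sets of velocity events). -/
abbrev VelEvent : Type := (V3 × V3) × (V3 × V3)

/-- The collision clock `κ_N = σ² (N+1)^{1/3}`: collisions per unit time and unit relative speed of one
sphere at reduced density `σ` (`(N+1) ε_N² = σ² (N+1)^{1/3}`); it multiplies EVERY flux of the line and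
cancels in the comparison. -/
def clock (σ : ℝ) (N : ℕ) : ℝ := σ ^ 2 * ((N : ℝ) + 1) ^ ((1 : ℝ) / 3)

/-- The expected LEVEL CENSUS `n_s(E) = E_{λ_N} #{i : E < ‖vᵢ(Φ_s z)‖²}` (an extended non-negative real;
at most `N + 1`). -/
def levelCensus (σ : ℝ) (a₀ θ₀ : T3 → ℝ) (u₀ : T3 → V3) (N : ℕ) (Φ : Flow σ N) (s E : ℝ) : ℝ≥0∞ :=
  ∫⁻ z, (∑ i : Fin (N + 1),
      Set.indicator {v : V3 | E < ‖v‖ ^ 2} (fun _ => (1 : ℝ≥0∞)) ((Φ.flow s z i).2))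
    ∂(localGibbsLaw σ a₀ u₀ θ₀ N Φ)

/-- The expected SHELL CENSUS `E_{λ_N} #{i : E₁ < ‖vᵢ(Φ_s z)‖² ≤ E₂}` (= `n_s(E₁) − n_s(E₂)`). -/
def shellCensus (σ : ℝ) (a₀ θ₀ : T3 → ℝ) (u₀ : T3 → V3) (N : ℕ) (Φ : Flow σ N)
    (s E₁ E₂ : ℝ) : ℝ≥0∞ :=
  ∫⁻ z, (∑ i : Fin (N + 1),
      Set.indicator {v : V3 | E₁ < ‖v‖ ^ 2 ∧ ‖v‖ ^ 2 ≤ E₂} (fun _ => (1 : ℝ≥0∞)) ((Φ.flow s z i).2))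
    ∂(localGibbsLaw σ a₀ u₀ θ₀ N Φ)

/-- The expected SPEED-WEIGHTED CENSUS above `Y`: `E_{λ_N} ∑ᵢ 𝟙{Y < ‖vᵢ(s)‖²} ‖vᵢ(s)‖` (the rate at
which particles above `Y` sweep volume; by layer-cake `√Y n_s(Y) + ∫_Y^∞ n_s(y) dy/(2√y)`, monotone
in the census). -/
def speedCensus (σ : ℝ) (a₀ θ₀ : T3 → ℝ) (u₀ : T3 → V3) (N : ℕ) (Φ : Flow σ N) (s Y : ℝ) : ℝ≥0∞ :=
  ∫⁻ z, (∑ i : Fin (N + 1),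
      Set.indicator {v : V3 | Y < ‖v‖ ^ 2} (fun v => ENNReal.ofReal ‖v‖) ((Φ.flow s z i).2))
    ∂(localGibbsLaw σ a₀ u₀ θ₀ N Φ)

/-- The expected total kinetic energy `E_{λ_N} ∑ᵢ ‖vᵢ(Φ_s z)‖²` at time `s`. -/
def kineticEnergy (σ : ℝ) (a₀ θ₀ : T3 → ℝ) (u₀ : T3 → V3) (N : ℕ) (Φ : Flow σ N) (s : ℝ) : ℝ≥0∞ :=
  ∫⁻ z, ENNReal.ofReal (∑ i : Fin (N + 1), ‖(Φ.flow s z i).2‖ ^ 2) ∂(localGibbsLaw σ a₀ u₀ θ₀ N Φ)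

/-- The pathwise VELOCITY-EVENT COUNT of the orbit of `z` over the window `(s, s′]`: the number of
collisions whose velocity event lies in `S` (each physical collision counted ONCE — the ordered contact
pairs list it twice, the guard `fst < snd` keeps one). -/
def eventSum {σ : ℝ} {N : ℕ} (Φ : Flow σ N) (s s' : ℝ) (S : Set VelEvent)
    (z : Config (N + 1) (Fin 3) T3) : ℝ≥0∞ :=
  Φ.collisionSum (Set.Ioc s s')
    (fun c => if c.fst < c.snd then Set.indicator S (fun _ => (1 : ℝ≥0∞)) (c.preVel, c.postVel) else 0) z

/-- The EXPECTED velocity-event count `E_{λ_N} #{collisions in (s,s′] with velocity event in S}`. -/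
def eventCount (σ : ℝ) (a₀ θ₀ : T3 → ℝ) (u₀ : T3 → V3) (N : ℕ) (Φ : Flow σ N) (s s' : ℝ)
    (S : Set VelEvent) : ℝ≥0∞ :=
  ∫⁻ z, eventSum Φ s s' S z ∂(localGibbsLaw σ a₀ u₀ θ₀ N Φ)

/-! ### The accounts of one collision at level `E` (Borel sets of velocity events) -/

/-- How many of the two velocities of a pair have energy `‖v‖²` above the level `E`. -/
def aboveCount (E : ℝ) (p : V3 × V3) : ℕ :=
  (if E < ‖p.1‖ ^ 2 then 1 else 0) + (if E < ‖p.2‖ ^ 2 then 1 else 0)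

/-- The larger of the two PRE-collisional energies of a velocity event. -/
def maxPre (q : VelEvent) : ℝ := max (‖q.1.1‖ ^ 2) (‖q.1.2‖ ^ 2)

/-- UP-CROSSING collisions at level `E`: the pair's count above `E` increases (by one, `κ_E = +1`). -/
def upEvent (E : ℝ) : Set VelEvent := {q | aboveCount E q.1 < aboveCount E q.2}

/-- DOWN-CROSSING collisions at level `E` (`κ_E = −1`). -/
def downEvent (E : ℝ) : Set VelEvent := {q | aboveCount E q.2 < aboveCount E q.1}

/-- SHELL collisions: some participant has pre-collisional energy in `(E₁, E₂]`. -/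
def shellEvent (E₁ E₂ : ℝ) : Set VelEvent :=
  {q | (E₁ < ‖q.1.1‖ ^ 2 ∧ ‖q.1.1‖ ^ 2 ≤ E₂) ∨ (E₁ < ‖q.1.2‖ ^ 2 ∧ ‖q.1.2‖ ^ 2 ≤ E₂)}

/-- TAIL collisions: some participant has pre-collisional energy above `Y`. -/
def tailEvent (Y : ℝ) : Set VelEvent := {q | Y < maxPre q}

/-- SPLITTING collisions at level `E`: the faster participant had energy in `(E, 3E/2]` and BOTH outgoing
energies are `≤ E` (so `κ_E = −1`; for a thermal partner this is the δ-splitting geometry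
`cos²ψ ∈ (1/3, 2/3)` up to `O(Δ/E)`). -/
def splitEvent (E : ℝ) : Set VelEvent :=
  {q | E < maxPre q ∧ maxPre q ≤ 3 / 2 * E ∧ ‖q.2.1‖ ^ 2 ≤ E ∧ ‖q.2.2‖ ^ 2 ≤ E}

/-- MERGE / SPALLATION up-crossings at level `E` with band width `Δ`: up-crossing, NO participant in the
band `(E−Δ, E]` (so the crosser was `≤ E − Δ` and its partner's normal energy exceeded `Δ`:
`upStep_le_partner_normal_energy`), faster participant at most `4E` (above that, F1's tail). -/
def mergeEvent (E Δ : ℝ) : Set VelEvent :=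
  upEvent E ∩ (shellEvent (E - Δ) E)ᶜ ∩ {q | maxPre q ≤ 4 * E}

/-- The PAIR MAJORANT of the merge/spallation account at level `E`, band width `Δ`, time `r` — the
census functional a one-sided no-affinity bound compares the expected pair events with (products of
EXPECTED counts, `/(N+1)` supplied by the stub): (merges) the faster participant in the arithmetic class
`(E−(k+1)Δ, E−kΔ]`, `1 ≤ k ≤ ⌈E/(2Δ)⌉`, the slower above the deficit `kΔ`; (spallation with the fast
partner above `E`) the crosser in the class `((j−1)Δ, (j+1)Δ]`, `0 ≤ j ≤ ⌈E/Δ⌉`, the partner above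
`2E − (j+1)Δ`.  At a near-touching level the comparison bounds every class CRUDELY (shell `≤` census at
its lower end), which is monotone in the cumulative census; only F1's band needs the diagonal term. -/
def pairMajorant (σ : ℝ) (a₀ θ₀ : T3 → ℝ) (u₀ : T3 → V3) (N : ℕ) (Φ : Flow σ N) (r E Δ : ℝ) :
    ℝ≥0∞ :=
  (∑ k ∈ Finset.Icc 1 ⌈E / (2 * Δ)⌉₊,
      shellCensus σ a₀ θ₀ u₀ N Φ r (E - ((k : ℝ) + 1) * Δ) (E - (k : ℝ) * Δ) *
        levelCensus σ a₀ θ₀ u₀ N Φ r ((k : ℝ) * Δ)) +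
    ∑ j ∈ Finset.range (⌈E / Δ⌉₊ + 1),
      shellCensus σ a₀ θ₀ u₀ N Φ r (((j : ℝ) - 1) * Δ) (((j : ℝ) + 1) * Δ) *
        levelCensus σ a₀ θ₀ u₀ N Φ r (2 * E - ((j : ℝ) + 1) * Δ)

/-! ## §1 The stub statements and the transfer statements (named `Prop`s; nothing asserted) -/

/-- **Stub A — THE CENSUS LEDGER AND THE A-PRIORI INPUTS (no chaos; provable now).**  For continuous
positive profiles there is `σ₀ > 0` (`1/2` works) such that for `0 < σ < σ₀` and every flow family:
(i) CROSSING LEDGER `n_{s′}(E) + E#{down-crossings at E in (s,s′]} = n_s(E) + E#{up-crossings}`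
(`0 ≤ s ≤ s′`; pathwise on the good set + `lintegral_add_left`, an identity in `ℝ≥0∞`);
(ii) KINETIC ENERGY `E_{λ_N} ∑ᵢ‖vᵢ(s)‖² ≤ (N+1) m₂` for all `s ≥ 0` (Gaussian data + conservation);
(iii) GAUSSIAN TAILS with one rate `α₀`: `n_0(E) ≤ K₀(N+1)e^{−α₀E}` and `n_s(E) ≤ K₀^{N+2}e^{−α₀E}`
for `s ≥ 0` (total-energy tail, conserved); (iv) `λ_N`-a.e. measurability of the velocity-event
counts `eventSum (Φ N) s s′ S` for Borel `S`.  Registered stub: `stub_censusLedger : CensusLedger`. -/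
def CensusLedger : Prop :=
    ∀ (a₀ θ₀ : T3 → ℝ) (u₀ : T3 → V3), Continuous a₀ → Continuous θ₀ → Continuous u₀ →
      (∀ x, 0 < a₀ x) → (∀ x, 0 < θ₀ x) →
      ∃ σ₀ : ℝ, 0 < σ₀ ∧ ∀ σ : ℝ, 0 < σ → σ < σ₀ →
        ∀ Φ : (N : ℕ) → HardSphereFlow (Torus.geometry (Fin 3)) (hsDiameter σ N) (N + 1),
          (∀ (N : ℕ) (s s' E : ℝ), 0 ≤ s → s ≤ s' →
              levelCensus σ a₀ θ₀ u₀ N (Φ N) s' E + eventCount σ a₀ θ₀ u₀ N (Φ N) s s' (downEvent E)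
                = levelCensus σ a₀ θ₀ u₀ N (Φ N) s E
                    + eventCount σ a₀ θ₀ u₀ N (Φ N) s s' (upEvent E)) ∧
          (∃ m₂ : ℝ, 0 < m₂ ∧ ∀ (N : ℕ) (s : ℝ), 0 ≤ s →
              kineticEnergy σ a₀ θ₀ u₀ N (Φ N) s ≤ ENNReal.ofReal (((N : ℝ) + 1) * m₂)) ∧
          (∃ α₀ : ℝ, 0 < α₀ ∧ ∃ K₀ : ℝ, 0 < K₀ ∧ ∀ (N : ℕ) (E : ℝ),
              levelCensus σ a₀ θ₀ u₀ N (Φ N) 0 E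
                  ≤ ENNReal.ofReal (K₀ * ((N : ℝ) + 1) * Real.exp (-α₀ * E)) ∧
              ∀ s : ℝ, 0 ≤ s → levelCensus σ a₀ θ₀ u₀ N (Φ N) s E
                ≤ ENNReal.ofReal (K₀ ^ (N + 2) * Real.exp (-α₀ * E))) ∧
          (∀ (N : ℕ) (s s' : ℝ) (S : Set VelEvent), MeasurableSet S →
              AEMeasurable (eventSum (Φ N) s s' S) (localGibbsLaw σ a₀ u₀ θ₀ N (Φ N)))

/-- **Stub F1 — THE COLLISION-RATE CEILING FOR ENERGETIC SHELLS AND TAILS (dynamical).**  In the frame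
of the crux, for every `t < T` there are `C₁ > 0`, a threshold `Eth` and `N₁` such that for `N ≥ N₁`,
`0 ≤ s ≤ s′ ≤ t`: (shells) for `Eth ≤ E₁ < E₂ ≤ 2E₁` the expected number of collisions in `(s,s′]`
with a participant of pre-energy in `(E₁, E₂]` is `≤ C₁ κ_N √E₂ (s′−s) · sup_{r∈[s,s′]} shellCensus`;
(tails) for `Y ≥ Eth` the expected number of collisions with a participant of pre-energy `> Y` is
`≤ C₁ κ_N (s′−s) · sup_{r∈[s,s′]} speedCensus`.  Count form of `CollisionActivityTails` (stmt-13734);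
`C₁ = C₁(σ, t, profiles)`.  Registered stub: `stub_rateCeiling : RateCeiling`. -/
def RateCeiling : Prop :=
    ∀ (a₀ θ₀ : T3 → ℝ) (u₀ : T3 → V3), Continuous a₀ → Continuous θ₀ → Continuous u₀ →
      (∀ x, 0 < a₀ x) → (∀ x, 0 < θ₀ x) →
      ∃ σ₀ : ℝ, 0 < σ₀ ∧ ∀ σ : ℝ, 0 < σ → σ < σ₀ →
        ∀ (T : ℝ) (ρ θ : ℝ → T3 → ℝ) (u : ℝ → T3 → V3), IsHardSphereEulerSolution σ T ρ u θ →
          ∀ Φ : (N : ℕ) → HardSphereFlow (Torus.geometry (Fin 3)) (hsDiameter σ N) (N + 1),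
            TendstoHydroFieldsAt (fun N => localGibbsLaw σ a₀ u₀ θ₀ N (Φ N)) Φ ρ u θ 0 →
              ∀ t ∈ Set.Ico 0 T, ∃ C₁ : ℝ, 0 < C₁ ∧ ∃ Eth : ℝ, ∃ N₁ : ℕ, ∀ N : ℕ, N₁ ≤ N →
                ∀ s s' : ℝ, 0 ≤ s → s ≤ s' → s' ≤ t →
                  (∀ E₁ E₂ : ℝ, Eth ≤ E₁ → E₁ < E₂ → E₂ ≤ 2 * E₁ →
                    eventCount σ a₀ θ₀ u₀ N (Φ N) s s' (shellEvent E₁ E₂)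
                      ≤ ENNReal.ofReal (C₁ * clock σ N * Real.sqrt E₂ * (s' - s)) *
                          ⨆ r ∈ Set.Icc s s', shellCensus σ a₀ θ₀ u₀ N (Φ N) r E₁ E₂) ∧
                  (∀ Y : ℝ, Eth ≤ Y →
                    eventCount σ a₀ θ₀ u₀ N (Φ N) s s' (tailEvent Y)
                      ≤ ENNReal.ofReal (C₁ * clock σ N * (s' - s)) *
                          ⨆ r ∈ Set.Icc s s', speedCensus σ a₀ θ₀ u₀ N (Φ N) r Y)

/-- **Stub F2 — THE MERGE / SPALLATION CEILING (dynamical; crux-strength; one-sided no-affinity).**  In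
the frame of the crux, for every `t < T` there are `A > 0` and `Δth > 0` such that for every band width
`Δ ≥ Δth` there is `N₂` with: for `N ≥ N₂`, `0 ≤ s ≤ s′ ≤ t`, `E ≥ 2Δ`, the expected number of
up-crossing collisions at level `E` in `(s,s′]` with NO participant in the band `(E−Δ, E]` and faster
participant `≤ 4E` is `≤ A κ_N √E (s′−s)/(N+1) · sup_{r∈[s,s′]} pairMajorant(r, E, Δ)` — energetic
spheres do not preferentially meet each other (propagation of chaos as a one-sided UPPER bound for
energetic pair events).  Registered stub: `stub_mergeCeiling : MergeCeiling`. -/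
def MergeCeiling : Prop :=
    ∀ (a₀ θ₀ : T3 → ℝ) (u₀ : T3 → V3), Continuous a₀ → Continuous θ₀ → Continuous u₀ →
      (∀ x, 0 < a₀ x) → (∀ x, 0 < θ₀ x) →
      ∃ σ₀ : ℝ, 0 < σ₀ ∧ ∀ σ : ℝ, 0 < σ → σ < σ₀ →
        ∀ (T : ℝ) (ρ θ : ℝ → T3 → ℝ) (u : ℝ → T3 → V3), IsHardSphereEulerSolution σ T ρ u θ →
          ∀ Φ : (N : ℕ) → HardSphereFlow (Torus.geometry (Fin 3)) (hsDiameter σ N) (N + 1),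
            TendstoHydroFieldsAt (fun N => localGibbsLaw σ a₀ u₀ θ₀ N (Φ N)) Φ ρ u θ 0 →
              ∀ t ∈ Set.Ico 0 T, ∃ A : ℝ, 0 < A ∧ ∃ Δth : ℝ, 0 < Δth ∧ ∀ Δ : ℝ, Δth ≤ Δ →
                ∃ N₂ : ℕ, ∀ N : ℕ, N₂ ≤ N → ∀ s s' : ℝ, 0 ≤ s → s ≤ s' → s' ≤ t →
                  ∀ E : ℝ, 2 * Δ ≤ E →
                    eventCount σ a₀ θ₀ u₀ N (Φ N) s s' (mergeEvent E Δ)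
                      ≤ ENNReal.ofReal (A * clock σ N * Real.sqrt E * (s' - s) / ((N : ℝ) + 1)) *
                          ⨆ r ∈ Set.Icc s s', pairMajorant σ a₀ θ₀ u₀ N (Φ N) r E Δ

/-- **Stub F3 — THE SPLITTING FLOOR (dynamical; crux-strength; the hardest stub).**  In the frame of
the crux, for every `t < T` there are `c > 0`, a level `Eth` and `N₃` such that for `N ≥ N₃`,
`0 ≤ s ≤ s′ ≤ t`, `E ≥ Eth`:
`c κ_N √E (s′−s) · inf_{r∈[s,s′]} E#{i : E < ‖vᵢ(r)‖² ≤ 3E/2} ≤ E#{splitting collisions at E in (s,s′]}`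
— particles in `(E, 3E/2]` are knocked below `E` (both outgoing energies `≤ E`) at a fixed fraction of
the Boltzmann rate, instantaneously in expectation (impact freshness for energetic projectiles, the
producer shared with `quartic_schur_ledger`'s loss floor S1).  Registered stub:
`stub_splitFloor : SplitFloor`. -/
def SplitFloor : Prop :=
    ∀ (a₀ θ₀ : T3 → ℝ) (u₀ : T3 → V3), Continuous a₀ → Continuous θ₀ → Continuous u₀ →
      (∀ x, 0 < a₀ x) → (∀ x, 0 < θ₀ x) →
      ∃ σ₀ : ℝ, 0 < σ₀ ∧ ∀ σ : ℝ, 0 < σ → σ < σ₀ →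
        ∀ (T : ℝ) (ρ θ : ℝ → T3 → ℝ) (u : ℝ → T3 → V3), IsHardSphereEulerSolution σ T ρ u θ →
          ∀ Φ : (N : ℕ) → HardSphereFlow (Torus.geometry (Fin 3)) (hsDiameter σ N) (N + 1),
            TendstoHydroFieldsAt (fun N => localGibbsLaw σ a₀ u₀ θ₀ N (Φ N)) Φ ρ u θ 0 →
              ∀ t ∈ Set.Ico 0 T, ∃ c : ℝ, 0 < c ∧ ∃ Eth : ℝ, ∃ N₃ : ℕ, ∀ N : ℕ, N₃ ≤ N →
                ∀ s s' : ℝ, 0 ≤ s → s ≤ s' → s' ≤ t → ∀ E : ℝ, Eth ≤ E →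
                  ENNReal.ofReal (c * clock σ N * Real.sqrt E * (s' - s)) *
                      (⨅ r ∈ Set.Icc s s', shellCensus σ a₀ θ₀ u₀ N (Φ N) r E (3 / 2 * E))
                    ≤ eventCount σ a₀ θ₀ u₀ N (Φ N) s s' (splitEvent E)

/-- **The transfer statement C⁺ — GAUSSIAN (exponential-in-energy) CENSUS BOUND**, pointwise in `s`,
uniformly in `N`: in the frame of the crux, for every `t < T` there are `α > 0`, `B`, `E₀`, `N₀` with
`n_s(E) ≤ B (N+1) e^{−αE}` for `N ≥ N₀`, `s ∈ [0,t]`, `E ≥ E₀` (Nachtergaele–Yau's cut-off II.1 in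
expectation form).  Conclusion of the registered stub `stub_censusClosure : CensusLedger → RateCeiling →
MergeCeiling → SplitFloor → GaussianCensusBound`; strictly stronger than the crux (it implies
`QuarticMomentBound` by layer cake, `stub_censusTransfer`). -/
def GaussianCensusBound : Prop :=
  ∀ (a₀ θ₀ : T3 → ℝ) (u₀ : T3 → V3), Continuous a₀ → Continuous θ₀ → Continuous u₀ →
    (∀ x, 0 < a₀ x) → (∀ x, 0 < θ₀ x) → ∃ σ₀ : ℝ, 0 < σ₀ ∧ ∀ σ : ℝ, 0 < σ → σ < σ₀ →
    ∀ (T : ℝ) (ρ θ : ℝ → T3 → ℝ) (u : ℝ → T3 → V3), IsHardSphereEulerSolution σ T ρ u θ →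
    ∀ Φ : (N : ℕ) → HardSphereFlow (Torus.geometry (Fin 3)) (hsDiameter σ N) (N + 1),
      TendstoHydroFieldsAt (fun N => localGibbsLaw σ a₀ u₀ θ₀ N (Φ N)) Φ ρ u θ 0 →
      ∀ t ∈ Set.Ico 0 T, ∃ α : ℝ, 0 < α ∧ ∃ B E₀ : ℝ, ∃ N₀ : ℕ, ∀ N : ℕ, N₀ ≤ N → ∀ s ∈ Set.Icc 0 t,
        ∀ E : ℝ, E₀ ≤ E →
          levelCensus σ a₀ θ₀ u₀ N (Φ N) s E ≤ ENNReal.ofReal (B * ((N : ℝ) + 1) * Real.exp (-α * E))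

/-- **The docking input C⁺′ — an `N`-uniform quartic velocity moment along the true flow**, verbatim
the hypothesis of the landed `…Theorems.LoschmidtTagging.stub_quarticDocking` (p92098) and
`quartic_schur_ledger`'s `QuarticMomentBound`; conclusion of the transfer `stub_censusTransfer :
GaussianCensusBound → QuarticMomentBound` (layer cake, proved in the skeleton §4). -/
def QuarticMomentBound : Prop :=
  ∀ (a₀ θ₀ : T3 → ℝ) (u₀ : T3 → V3), Continuous a₀ → Continuous θ₀ → Continuous u₀ →
    (∀ x, 0 < a₀ x) → (∀ x, 0 < θ₀ x) → ∃ σ₀ : ℝ, 0 < σ₀ ∧ ∀ σ : ℝ, 0 < σ → σ < σ₀ →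
    ∀ (T : ℝ) (ρ θ : ℝ → T3 → ℝ) (u : ℝ → T3 → V3), IsHardSphereEulerSolution σ T ρ u θ →
    ∀ Φ : (N : ℕ) → HardSphereFlow (Torus.geometry (Fin 3)) (hsDiameter σ N) (N + 1),
    TendstoHydroFieldsAt (fun N => localGibbsLaw σ a₀ u₀ θ₀ N (Φ N)) Φ ρ u θ 0 →
    ∀ t ∈ Set.Ico 0 T, ∃ C : ℝ, ∃ N₀ : ℕ, ∀ N : ℕ, N₀ ≤ N → ∀ s ∈ Set.Icc 0 t,
      ∫⁻ z, ENNReal.ofReal (((N : ℝ) + 1)⁻¹ * ∑ i : Fin (N + 1), ‖((Φ N).flow s z i).2‖ ^ 4)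
        ∂(localGibbsLaw σ a₀ u₀ θ₀ N (Φ N)) ≤ ENNReal.ofReal C


/-! ## §2 The continuous-time comparison principle (the analytic engine of stub C; proved) -/

/-- **Comparison principle, continuous time** (registered helper `comparison_principle` of the line;
first-violation-time argument for a family of levels WITHOUT a CFL condition and WITHOUT attaining a
supremum over levels).  Let `n : ℝ → ℝ → ℝ` (time, level), `b : ℝ → ℝ`, a level set `L`, `0 ≤ K`,
`0 < δ₀`.  Assume (h0) `n 0 E ≤ b E` on `L`; (hlip) for `E ∈ L` and `0 ≤ r ≤ r′ ≤ t`,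
`n r′ E ≤ n r E + K (r′ − r)`; (hdec) for `E ∈ L`, `0 ≤ u < r′ ≤ t` with `r′ − u ≤ δ₀`: if
`n r E′ ≤ b E′ + δ₀` for all `r ∈ [u,r′]`, `E′ ∈ L`, and `b E − δ₀ ≤ n r E` for all `r ∈ [u,r′]`, then
`n r′ E ≤ n u E`.  Then `n r E ≤ b E` for all `r ∈ [0,t]`, `E ∈ L`.  (Stub C instantiates it at fixed
`N` with `n r E := (levelCensus … r E).toReal` and the barrier `b(E) = β(N+1)e^{−αE}E^{−3/2}`.) -/
theorem comparison_principle :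
    ∀ {n : ℝ → ℝ → ℝ} {b : ℝ → ℝ} {L : Set ℝ} {t K δ₀ : ℝ}, 0 ≤ K → 0 < δ₀ →
      (∀ E ∈ L, n 0 E ≤ b E) →
      (∀ E ∈ L, ∀ r r' : ℝ, 0 ≤ r → r ≤ r' → r' ≤ t → n r' E ≤ n r E + K * (r' - r)) →
      (∀ E ∈ L, ∀ u r' : ℝ, 0 ≤ u → u < r' → r' ≤ t → r' - u ≤ δ₀ →
        (∀ r ∈ Set.Icc u r', ∀ E' ∈ L, n r E' ≤ b E' + δ₀) →
        (∀ r ∈ Set.Icc u r', b E - δ₀ ≤ n r E) →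
        n r' E ≤ n u E) →
      ∀ r ∈ Set.Icc 0 t, ∀ E ∈ L, n r E ≤ b E := by
  intro n b L t K δ₀ hK hδ₀ h0 hlip hdec
  by_contra hcon
  push Not at hcon
  -- the set of violation times and its infimum
  set V : Set ℝ := {r | r ∈ Set.Icc 0 t ∧ ∃ E ∈ L, b E < n r E} with hV
  obtain ⟨r₀, hr₀, E₀', hE₀', hviol₀⟩ := hcon
  have hVne : V.Nonempty := ⟨r₀, hr₀, E₀', hE₀', hviol₀⟩
  have hVbdd : BddBelow V := ⟨0, fun r hr => hr.1.1⟩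
  set s₀ : ℝ := sInf V with hs₀
  have hs₀_le : ∀ r ∈ V, s₀ ≤ r := fun r hr => csInf_le hVbdd hr
  have hs₀_nonneg : 0 ≤ s₀ := le_csInf hVne fun r hr => hr.1.1
  have hs₀_le_t : s₀ ≤ t := (hs₀_le r₀ ⟨hr₀, E₀', hE₀', hviol₀⟩).trans hr₀.2
  -- (A) no violation strictly before `s₀`
  have hbefore : ∀ r, 0 ≤ r → r < s₀ → ∀ E ∈ L, n r E ≤ b E := by
    intro r hr0 hrs E hE
    by_contra h
    push Not at h
    have hrV : r ∈ V := ⟨⟨hr0, le_of_lt (lt_of_lt_of_le hrs hs₀_le_t)⟩, E, hE, h⟩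
    exact absurd (hs₀_le r hrV) (not_le.2 hrs)
  -- (B) no violation at `s₀` itself (upward Lipschitz from times just before `s₀`, or `h0` if `s₀ = 0`)
  have hat : ∀ E ∈ L, n s₀ E ≤ b E := by
    intro E hE
    rcases eq_or_lt_of_le hs₀_nonneg with h0eq | hpos
    · rw [← h0eq]; exact h0 E hE
    · -- for every small `η > 0`: `n s₀ E ≤ n (s₀ - η) E + K η ≤ b E + K η`
      apply le_of_forall_pos_lt_add
      intro ε hε
      obtain ⟨η, hη, hηs, hηε⟩ : ∃ η : ℝ, 0 < η ∧ η ≤ s₀ ∧ K * η < ε := by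
        refine ⟨min s₀ (ε / (K + 1)), lt_min hpos (by positivity), min_le_left _ _, ?_⟩
        have h1 : min s₀ (ε / (K + 1)) ≤ ε / (K + 1) := min_le_right _ _
        have h2 : K * (ε / (K + 1)) < ε := by
          rw [mul_div_assoc']
          rw [div_lt_iff₀ (by positivity)]
          nlinarith
        exact lt_of_le_of_lt (mul_le_mul_of_nonneg_left h1 hK) h2
      have h1 := hlip E hE (s₀ - η) s₀ (by linarith) (by linarith) hs₀_le_t
      have h2 := hbefore (s₀ - η) (by linarith) (by linarith) E hE
      calc n s₀ E ≤ n (s₀ - η) E + K * (s₀ - (s₀ - η)) := h1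
        _ = n (s₀ - η) E + K * η := by ring
        _ < b E + ε := by linarith
  -- (C) a violation shortly after `s₀`
  obtain ⟨η, hη, hηδ, hKη⟩ : ∃ η : ℝ, 0 < η ∧ η ≤ δ₀ ∧ K * η ≤ δ₀ := by
    refine ⟨min δ₀ (δ₀ / (K + 1)), lt_min hδ₀ (by positivity), min_le_left _ _, ?_⟩
    have h1 : min δ₀ (δ₀ / (K + 1)) ≤ δ₀ / (K + 1) := min_le_right _ _
    have h2 : K * (δ₀ / (K + 1)) ≤ δ₀ := by
      rw [mul_div_assoc', div_le_iff₀ (by positivity)]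
      nlinarith
    exact (mul_le_mul_of_nonneg_left h1 hK).trans h2
  obtain ⟨r', hr'V, hr'lt⟩ : ∃ r' ∈ V, r' < s₀ + η := by
    have := exists_lt_of_csInf_lt hVne (show sInf V < s₀ + η by linarith)
    obtain ⟨r', hr'V, hlt⟩ := this
    exact ⟨r', hr'V, hlt⟩
  obtain ⟨hr't, E, hE, hviol⟩ := hr'V
  have hs₀r' : s₀ ≤ r' := hs₀_le r' ⟨hr't, E, hE, hviol⟩
  -- `r'` is not `s₀` (no violation at `s₀`), hence strictly later
  have hlt : s₀ < r' := by
    rcases eq_or_lt_of_le hs₀r' with h | h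
    · exact absurd (h ▸ hat E hE) (not_le.2 hviol)
    · exact h
  -- premises of the conditional decrease on the window `(s₀, r']`
  have hwin_above : ∀ r ∈ Set.Icc s₀ r', ∀ E' ∈ L, n r E' ≤ b E' + δ₀ := by
    intro r hr E' hE'
    have h1 := hlip E' hE' s₀ r hs₀_nonneg hr.1 (hr.2.trans hr't.2)
    have h2 := hat E' hE'
    have h3 : K * (r - s₀) ≤ K * η := mul_le_mul_of_nonneg_left (by linarith [hr.2]) hK
    linarith
  have hwin_below : ∀ r ∈ Set.Icc s₀ r', b E - δ₀ ≤ n r E := by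
    intro r hr
    have h1 := hlip E hE r r' (hs₀_nonneg.trans hr.1) hr.2 hr't.2
    have h3 : K * (r' - r) ≤ K * η := mul_le_mul_of_nonneg_left (by linarith [hr.1]) hK
    linarith
  have hdec' := hdec E hE s₀ r' hs₀_nonneg hlt hr't.2 (by linarith) hwin_above hwin_below
  -- contradiction: `b E < n r' E ≤ n s₀ E ≤ b E`
  exact absurd (hdec'.trans (hat E hE)) (not_le.2 hviol)

end Summit.AtomisticToContinuum.HydrodynamicLimit.Theorems.EnergyCurrentTailsLevelCensus

end
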